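import Summits.AtomisticToContinuum.FouriersLaw.Theorems.HonestZwanzigPositiveMemoryRowLimit
import Summits.AtomisticToContinuum.FouriersLaw.Theorems.HonestZwanzigOrthogonalOhmFeshbachIdentities
import Summits.AtomisticToContinuum.FouriersLaw.Theorems.PositiveMemory.Negative.ExistenceBarrier

/-!
# HonestZwanzig / PositiveMemory — exact Kirchhoff flatness AT `s = 0` (line `Sketch`, skeleton v10, stub
# `stub_lapZeroFlat`)

Support file for crux item `stmt-AtomisticToContinuum-12694` (`HonestZwanzig.PositiveMemory`, sub-problem
`FouriersLaw`), line `Sketch`, registered stub `stub_lapZeroFlat`.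

For `pinnedChain ω₂ lam β γ` (all `> 0`), `T > 0`, `N ≥ 2` and every genuine bond `b` (`b + 1 < N`):
`∫₀^∞ corr(j_b, J) = ∫₀^∞ corr(J, J) / (N − 1)` — the time-INTEGRATED response of the bond current `j_b` to the total
current `J = Σ_i j_i` is the same number on every genuine bond.

Proof: two limits of the same function `s ↦ lap_s(j_b, J) = ∫₀^∞ e^{-st} corr(j_b, J)(t) dt` along the `NeBot` filter
`𝓝[>] 0`, and uniqueness of limits (`tendsto_nhds_unique`):
* the landed `stub_rowLimit` (Kirchhoff flatness in the limit, fed the landed `FeshbachIdentities` package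
  `HonestZwanzig.stub_feshbachIdentities`) gives `lap_s(j_b, J) → ∫₀^∞corr(J,J)/(N−1)`;
* dominated convergence (`corr(j_b, J) ∈ L¹(0,∞)`, clause (i) of the same package; `j_b`, `J` admissible by
  `NetworkReduction.adm_bondCurrent` / `adm_totalCurrent`) gives `lap_s(j_b, J) → ∫₀^∞corr(j_b, J)`
  (`Negative.ExistenceBarrier.tendsto_lap_of_adm`).

No definitions, no named facts, no `sorry`.
-/

noncomputable section

open MeasureTheory Finset Real Set Filter Topology
open Literature.MathematicalPhysics.KineticTheory.HeatConduction
open Summit.AtomisticToContinuum.FouriersLaw.Theorems.HonestZwanzig.NetworkReduction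
open Summit.AtomisticToContinuum.FouriersLaw.Theorems.PositiveMemory.Negative.ExistenceBarrier

namespace Summit.AtomisticToContinuum.FouriersLaw.Theorems.HonestZwanzig.PositiveMemory

/-- **Stub `stub_lapZeroFlat` — exact Kirchhoff flatness at `s = 0`** (registered signature, line `Sketch` v10):
for `pinnedChain ω₂ lam β γ` (all `> 0`), `T > 0`, `N ≥ 2` and every genuine bond `b` (`b + 1 < N`),
`∫₀^∞ corr(j_b, J) = ∫₀^∞ corr(J, J) / (N − 1)`. Both sides are limits as `s ↓ 0` of `lap_s(j_b, J)`:
the right one by `stub_rowLimit` (fed `stub_feshbachIdentities`), the left one by dominated convergence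
(`tendsto_lap_of_adm`, `corr(j_b, J) ∈ L¹(0,∞)`); conclude by `tendsto_nhds_unique` in the `NeBot` filter `𝓝[>] 0`. -/
theorem stub_lapZeroFlat :
    ∀ ω₂ lam β γ : ℝ, 0 < ω₂ → 0 < lam → 0 < β → 0 < γ → ∀ T : ℝ, 0 < T → ∀ N : ℕ, 2 ≤ N →
    let P := Literature.MathematicalPhysics.KineticTheory.HeatConduction.pinnedChain ω₂ lam β γ;
    let X := Literature.MathematicalPhysics.KineticTheory.HeatConduction.PhaseSpace N;
    let μ : MeasureTheory.Measure X := P.gibbsMeasure N T;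
    let corr : (X → ℝ) → (X → ℝ) → ℝ → ℝ := fun f g t =>
      (∫ z, f z * (∫ y, g y ∂(P.transitionKernel N T T t.toNNReal z)) ∂μ) - (∫ z, f z ∂μ) * (∫ z, g z ∂μ);
    let J : X → ℝ := fun z => ∑ i : Fin N, P.bondCurrent N i z;
    ∀ b : Fin N, b.val + 1 < N →
      (∫ t in Set.Ioi (0 : ℝ), corr (P.bondCurrent N b) J t) =
        (∫ t in Set.Ioi (0 : ℝ), corr J J t) / ((N : ℝ) - 1) := by
  intro ω₂ lam β γ hω hl hβ hγ T hT N hN P X μ corr J b hb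
  -- clause (i) of the landed `FeshbachIdentities` package: `corr(f,g) ∈ L¹(0,∞)` for admissible `f, g`
  obtain ⟨-, hFI2, -, -⟩ :=
    Summit.AtomisticToContinuum.FouriersLaw.Theorems.HonestZwanzig.stub_feshbachIdentities
      ω₂ lam β γ hω hl hβ hγ T hT N hN
  -- limit no. 1 (dominated convergence): `lap_s(j_b, J) → ∫₀^∞ corr(j_b, J)`
  have h1 : Tendsto (fun s => ∫ t in Set.Ioi (0 : ℝ), Real.exp (-(s * t)) * corr (P.bondCurrent N b) J t)
      (nhdsWithin (0 : ℝ) (Set.Ioi 0)) (nhds (∫ t in Set.Ioi (0 : ℝ), corr (P.bondCurrent N b) J t)) :=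
    tendsto_lap_of_adm (N := N)
      (Adm := fun f => Continuous f ∧ ∃ A : ℝ, ∀ z,
        |f z| ≤ A * Real.exp ((pinnedChain ω₂ lam β γ).hamiltonian N z / (8 * T)))
      (corr := corr) (lap := fun s f g => ∫ t in Set.Ioi (0 : ℝ), Real.exp (-(s * t)) * corr f g t)
      (fun s f g => rfl) (fun f g hf hg => (hFI2 f g hf hg).2.2.1)
      (adm_bondCurrent _ (fun f => Iff.rfl) hω hl.le hβ.le hT b)
      (adm_totalCurrent _ (fun f => Iff.rfl) hω hl.le hβ.le hT)
  -- limit no. 2 (Kirchhoff flatness in the limit, `stub_rowLimit`): `lap_s(j_b, J) → ∫₀^∞ corr(J,J)/(N−1)`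
  have h2 : Tendsto (fun s => ∫ t in Set.Ioi (0 : ℝ), Real.exp (-(s * t)) * corr (P.bondCurrent N b) J t)
      (nhdsWithin (0 : ℝ) (Set.Ioi 0)) (nhds ((∫ t in Set.Ioi (0 : ℝ), corr J J t) / ((N : ℝ) - 1))) :=
    stub_rowLimit Summit.AtomisticToContinuum.FouriersLaw.Theorems.HonestZwanzig.stub_feshbachIdentities
      ω₂ lam β γ hω hl hβ hγ T hT N hN b hb
  exact tendsto_nhds_unique h1 h2

end Summit.AtomisticToContinuum.FouriersLaw.Theorems.HonestZwanzig.PositiveMemory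

end
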